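import Summits.AtomisticToContinuum.Crystallization.Theorems.ExcessDecayLiouvillePhononStabilityDefs
import Summits.AtomisticToContinuum.Crystallization.Theorems.ExcessDecayLiouvillePhononStabilityWindow

/-!
# `PhononStability` (stmt-AtomisticToContinuum-9333), line `contragredient-window-collapse`: stub `stub_tail`

Reduction S3 of the line (`TailControl`, one-sided far-field control in `tsum` form): for a range
`R ≥ 2`, a window cell `A` (`CellWindow A`), a shift error `δ` (`ShiftWindow A δ`) and a finitely
supported label field `w` whose lattice sum converges (`LatticeSummable w`) and whose class family
`classTerm A B δ w` is summable,
`−tailForm R w ≤ ∑' c, (if c ∈ classesR R then 0 else classTerm A B δ w c)`.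

* **Box coverage.** A class `c = (m, m', n)` outside `classesR R` has reference length `‖ζ⁰_c‖ > R`:
  by the coordinate formula `36‖ζ⁰_c‖² = 9(2n₀ + n₁ + s)² + 3(3n₁ + s)² + 24(2n₂ + s)²` of the Window file,
  `‖ζ⁰_c‖ ≤ R` forces `|nᵢ| ≤ 2R + 1 ≤ ⌈2R⌉₊ + 1`, i.e. `c ∈ classBox R`.
* **Far bonds.** For such `c`, `ρ := ‖ζ⁰_c‖ > R ≥ 2`, the pulled-back bond `ζ = ζ_c(δ)` has
  `‖ζ‖ ≥ ρ − 5/189` and actual length `r = ‖Aζ‖ ≥ (189/200)‖ζ‖ > 1.86 > 1`; hence `ψ(r) = r⁻⁸ − r⁻¹⁴ ≥ 0`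
  (dropped, `metricForm ≥ 0`), `ω(r) ≥ −8r⁻¹⁰`, and by termwise Cauchy–Schwarz
  `longForm ≤ ‖ζ‖²·plainForm`; the scalar inequality `8r⁻¹⁰‖ζ‖² ≤ 18ρ⁻⁸` (reduced to
  `8·378⁸·200¹⁰ ≤ 18·373⁸·189¹⁰`-type numerals) gives `classTerm_c ≥ −farCoeff c · plainForm c w`.
* **Summation.** The far class family is the summable class family minus a finitely supported one, the
  tail family is dominated by `18×` the lattice-sum family; `tsum_le_tsum` and `tsum_neg` conclude.

All `[folklore]`.
-/

noncomputable section

open scoped BigOperators Classical InnerProductSpace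
open Filter Set Function
open Literature.MathematicalPhysics.StatisticalMechanics
open Summit.AtomisticToContinuum.Crystallization.Theses.ExcessDecayLiouville
open Summit.AtomisticToContinuum.Crystallization.Theorems.PhononStabilityNegative
open Summit.AtomisticToContinuum.Crystallization.Theorems.PhononStabilityCWC

namespace Summit.AtomisticToContinuum.Crystallization.Theorems.PhononStabilityCWC.TailStub

/-! ## Copies of the line's Basics lemmas (not yet in the tree) -/

/-- `refPos δ (m, n) = latVec n + σ(m)·(innerRef + δ)`; copy of the line's Basics lemma. [folklore] -/
private theorem refPos_eq (δ : EuclideanSpace ℝ (Fin 3)) (ℓ : Label) :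
    refPos δ ℓ = latVec ℓ.2 + subSign ℓ.1 • (innerRef + δ) := by
  unfold refPos subSign
  split_ifs <;> simp

/-- `ζ_c(δ) = ζ⁰_c + (σ(m') − σ(m))·δ`; copy of the line's Basics lemma. [folklore] -/
private theorem bondVec_eq (δ : EuclideanSpace ℝ (Fin 3)) (c : BondClass) :
    bondVec δ c = bondVec 0 c + (subSign c.2.1 - subSign c.1) • δ := by
  simp only [bondVec, refPos_eq, smul_add, sub_smul, add_zero]
  abel

/-- `|σ(m') − σ(m)| ≤ 1`; copy of the line's Basics lemma. [folklore] -/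
private theorem abs_subSign_sub_le (m m' : Fin 2) : |subSign m' - subSign m| ≤ 1 := by
  unfold subSign
  split_ifs <;> norm_num

/-- The bond vector moves by at most `‖δ‖` under the shift; copy of the line's Basics lemma. [folklore] -/
private theorem norm_bondVec_sub_le (δ : EuclideanSpace ℝ (Fin 3)) (c : BondClass) :
    ‖bondVec δ c - bondVec 0 c‖ ≤ ‖δ‖ := by
  rw [bondVec_eq δ c, add_sub_cancel_left, norm_smul, Real.norm_eq_abs]
  calc |subSign c.2.1 - subSign c.1| * ‖δ‖ ≤ 1 * ‖δ‖ :=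
        mul_le_mul_of_nonneg_right (abs_subSign_sub_le _ _) (norm_nonneg _)
    _ = ‖δ‖ := one_mul _

/-- Shift bound `‖δ‖ ≤ 5/189` from `‖Aδ‖ ≤ 1/40` and the lower stretch; copy of the line's Basics lemma.
[folklore] -/
private theorem norm_shift_le {A : EuclideanSpace ℝ (Fin 3) →L[ℝ] EuclideanSpace ℝ (Fin 3)}
    {δ : EuclideanSpace ℝ (Fin 3)} (hW : CellWindow A) (hδ : ShiftWindow A δ) : ‖δ‖ ≤ 5 / 189 := by
  have h1 := (hW δ).1
  unfold ShiftWindow at hδ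
  linarith

/-- `X_c ≥ 0`; copy of the line's Basics lemma. [folklore] -/
private theorem longForm_nonneg (δ : EuclideanSpace ℝ (Fin 3)) (c : BondClass)
    (w : Label → EuclideanSpace ℝ (Fin 3)) : 0 ≤ longForm δ c w :=
  tsum_nonneg fun _ => by positivity

/-- `Y_c ≥ 0`; copy of the line's Basics lemma. [folklore] -/
private theorem metricForm_nonneg (B : EuclideanSpace ℝ (Fin 3) →L[ℝ] EuclideanSpace ℝ (Fin 3))
    (c : BondClass) (w : Label → EuclideanSpace ℝ (Fin 3)) : 0 ≤ metricForm B c w :=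
  tsum_nonneg fun _ => by positivity

/-- `Σ_k ‖Δ_c w k‖² ≥ 0`; copy of the line's Basics lemma. [folklore] -/
private theorem plainForm_nonneg (c : BondClass) (w : Label → EuclideanSpace ℝ (Fin 3)) :
    0 ≤ plainForm c w :=
  tsum_nonneg fun _ => by positivity

/-- `farCoeff ≥ 0`; copy of the line's Basics lemma. [folklore] -/
private theorem farCoeff_nonneg (c : BondClass) : 0 ≤ farCoeff c := by
  unfold farCoeff; positivity

/-! ## Box coverage: `‖ζ⁰_c‖ ≤ R ⇒ c ∈ classBox R` -/

/-- **Box coverage:** a class of reference length `≤ R` lies in `classBox R`: by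
`36‖ζ⁰‖² = 9(2n₀ + n₁ + s)² + 3(3n₁ + s)² + 24(2n₂ + s)²` (`|s| ≤ 1`), `‖ζ⁰‖ ≤ R` gives
`|2n₂ + s| ≤ 2R`, `|3n₁ + s| ≤ 4R`, `|2n₀ + n₁ + s| ≤ 2R`, whence `|nᵢ| ≤ 2R + 1 ≤ ⌈2R⌉₊ + 1`. [folklore] -/
theorem mem_classBox_of_norm_le {R : ℝ} {c : BondClass} (h : ‖bondVec 0 c‖ ≤ R) : c ∈ classBox R := by
  obtain ⟨m, m', n⟩ := c
  have hq := WindowStub.norm_sq_bondVec_zero m m' n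
  have hs := abs_le.mp (abs_subSign_sub_le m m')
  set s : ℝ := subSign m' - subSign m
  have hR : 0 ≤ R := (norm_nonneg _).trans h
  have hρ2 : ‖bondVec 0 (m, m', n)‖ ^ 2 ≤ R ^ 2 := pow_le_pow_left₀ (norm_nonneg _) h 2
  have hX := sq_nonneg (2 * (n 0 : ℝ) + n 1 + s)
  have hY := sq_nonneg (3 * (n 1 : ℝ) + s)
  have hZ := sq_nonneg (2 * (n 2 : ℝ) + s)
  have h2 := abs_le_of_sq_le_sq' (a := 2 * (n 2 : ℝ) + s) (b := 2 * R) (by nlinarith) (by linarith)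
  have h1 := abs_le_of_sq_le_sq' (a := 3 * (n 1 : ℝ) + s) (b := 4 * R) (by nlinarith) (by linarith)
  have h0 :=
    abs_le_of_sq_le_sq' (a := 2 * (n 0 : ℝ) + n 1 + s) (b := 2 * R) (by nlinarith) (by linarith)
  have b0 : -(2 * R + 1) ≤ (n 0 : ℝ) ∧ (n 0 : ℝ) ≤ 2 * R + 1 := by constructor <;> linarith
  have b1 : -(2 * R + 1) ≤ (n 1 : ℝ) ∧ (n 1 : ℝ) ≤ 2 * R + 1 := by constructor <;> linarith
  have b2 : -(2 * R + 1) ≤ (n 2 : ℝ) ∧ (n 2 : ℝ) ≤ 2 * R + 1 := by constructor <;> linarith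
  have hK : 2 * R ≤ (⌈2 * R⌉₊ : ℝ) := Nat.le_ceil _
  have key : ∀ i : Fin 3, -(2 * R + 1) ≤ (n i : ℝ) ∧ (n i : ℝ) ≤ 2 * R + 1 := by
    intro i
    fin_cases i
    · exact b0
    · exact b1
    · exact b2
  simp only [classBox, Finset.mem_product, Finset.mem_univ, true_and, Fintype.mem_piFinset,
    Finset.mem_Icc]
  intro i
  obtain ⟨hl, hu⟩ := key i
  constructor
  · have : (((-((⌈2 * R⌉₊ : ℤ) + 1)) : ℤ) : ℝ) ≤ ((n i : ℤ) : ℝ) := by push_cast; linarith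
    exact Int.cast_le.mp this
  · have : ((n i : ℤ) : ℝ) ≤ (((⌈2 * R⌉₊ : ℤ) + 1 : ℤ) : ℝ) := by push_cast; linarith
    exact Int.cast_le.mp this

/-- Classes outside `classesR R` have reference length `> R`. [folklore] -/
theorem lt_norm_of_notMem {R : ℝ} {c : BondClass} (hc : c ∉ classesR R) : R < ‖bondVec 0 c‖ := by
  by_contra h
  have h' : ‖bondVec 0 c‖ ≤ R := not_lt.mp h
  exact hc (by unfold classesR; exact Finset.mem_filter.mpr ⟨mem_classBox_of_norm_le h', h'⟩)

/-! ## Far bonds -/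

/-- **The far-bond constant:** for `ρ ≥ 2`, `z ≥ ρ − 5/189` and `r ≥ (189/200)z`,
`8r⁻¹⁰z² ≤ 18ρ⁻⁸` (numerically `sup = 16.52 < 18`; here via `(373ρ)⁸ ≤ (378z)⁸`, `(189z)¹⁰ ≤ (200r)¹⁰`). [folklore] -/
theorem far_scalar {ρ z r : ℝ} (hρ : 2 ≤ ρ) (hz : ρ - 5 / 189 ≤ z) (hr : 189 / 200 * z ≤ r) :
    8 * r⁻¹ ^ 10 * z ^ 2 ≤ 18 * ρ⁻¹ ^ 8 := by
  have hρpos : 0 < ρ := by linarith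
  have hzpos : 0 < z := by linarith
  have hrpos : 0 < r := by linarith
  have hz' : 373 * ρ ≤ 378 * z := by linarith
  have hr' : 189 * z ≤ 200 * r := by linarith
  have h1 : (373 * ρ) ^ 8 ≤ (378 * z) ^ 8 := pow_le_pow_left₀ (by positivity) hz' 8
  have h2 : (189 * z) ^ 10 ≤ (200 * r) ^ 10 := pow_le_pow_left₀ (by positivity) hr' 10
  rw [mul_pow, mul_pow] at h1 h2
  have hz8 : 0 ≤ z ^ 8 := by positivity
  have hr10 : 0 ≤ r ^ 10 := by positivity
  have h1w : 89 * ρ ^ 8 ≤ 100 * z ^ 8 := by linarith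
  have h2w : 56 * z ^ 10 ≤ 100 * r ^ 10 := by linarith
  have h3w : z ^ 2 * (89 * ρ ^ 8) ≤ z ^ 2 * (100 * z ^ 8) :=
    mul_le_mul_of_nonneg_left h1w (sq_nonneg z)
  have key : 8 * z ^ 2 * ρ ^ 8 ≤ 18 * r ^ 10 := by nlinarith
  rw [inv_pow, inv_pow, show 8 * (r ^ 10)⁻¹ * z ^ 2 = (8 * z ^ 2) / r ^ 10 by ring,
    show (18 : ℝ) * (ρ ^ 8)⁻¹ = 18 / ρ ^ 8 by ring, div_le_div_iff₀ (by positivity) (by positivity)]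
  linarith

/-- The algebra of the far-bond bound: `ωL + ψM ≥ −far·P` from `ψ, M, L, P ≥ 0`, `ω ≥ −8q`, `q ≥ 0`,
`L ≤ z²P` and `8qz² ≤ far`. [folklore] -/
theorem far_combine {ω ψ L M P z2 q far : ℝ} (hM : 0 ≤ M) (hL : 0 ≤ L) (hP : 0 ≤ P) (hψ : 0 ≤ ψ)
    (hq : 0 ≤ q) (hω : -(8 * q) ≤ ω) (hLP : L ≤ z2 * P) (hsc : 8 * q * z2 ≤ far) :
    -(far * P) ≤ ω * L + ψ * M := by
  nlinarith [mul_nonneg hψ hM, mul_le_mul_of_nonneg_right hω hL, mul_le_mul_of_nonneg_left hLP hq,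
    mul_le_mul_of_nonneg_right hsc hP]

/-- For finitely supported `w`, `k ↦ ‖Δ_c w k‖²` is finitely supported (`k ↦ (m', k + n)` and
`k ↦ (m, k)` are injective). [folklore] -/
theorem hasFiniteSupport_normSq_bondDiff (c : BondClass) {w : Label → EuclideanSpace ℝ (Fin 3)}
    (hw : (support w).Finite) : (fun k => ‖bondDiff c w k‖ ^ 2).HasFiniteSupport := by
  have hw' : w.HasFiniteSupport := hw
  have h1 : (fun k : Fin 3 → ℤ => w (c.2.1, k + c.2.2)).HasFiniteSupport :=
    hw'.fun_comp_of_injective (g := fun k : Fin 3 → ℤ => (c.2.1, k + c.2.2))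
      fun k k' hk => by simpa using hk
  have h2 : (fun k : Fin 3 → ℤ => w (c.1, k)).HasFiniteSupport :=
    hw'.fun_comp_of_injective (g := fun k : Fin 3 → ℤ => (c.1, k)) (Prod.mk_right_injective _)
  have h3 : (bondDiff c w).HasFiniteSupport := (h1.union h2).subset (support_sub _ _)
  exact h3.fun_comp (g := fun v : EuclideanSpace ℝ (Fin 3) => ‖v‖ ^ 2) (by simp)

/-- **Termwise Cauchy–Schwarz:** `X_c(δ, w) ≤ ‖ζ_c(δ)‖² · Σ_k ‖Δ_c w k‖²` for finitely supported `w`.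
[folklore] -/
theorem longForm_le (δ : EuclideanSpace ℝ (Fin 3)) (c : BondClass)
    {w : Label → EuclideanSpace ℝ (Fin 3)} (hw : (support w).Finite) :
    longForm δ c w ≤ ‖bondVec δ c‖ ^ 2 * plainForm c w := by
  have hs : Summable fun k => ‖bondVec δ c‖ ^ 2 * ‖bondDiff c w k‖ ^ 2 :=
    (summable_of_hasFiniteSupport (hasFiniteSupport_normSq_bondDiff c hw)).mul_left _
  have hle : ∀ k, (inner ℝ (bondVec δ c) (bondDiff c w k)) ^ 2 ≤
      ‖bondVec δ c‖ ^ 2 * ‖bondDiff c w k‖ ^ 2 := fun k =>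
    calc (inner ℝ (bondVec δ c) (bondDiff c w k)) ^ 2
          = |inner ℝ (bondVec δ c) (bondDiff c w k)| ^ 2 := (sq_abs _).symm
      _ ≤ (‖bondVec δ c‖ * ‖bondDiff c w k‖) ^ 2 :=
          pow_le_pow_left₀ (abs_nonneg _) (abs_real_inner_le_norm _ _) 2
      _ = ‖bondVec δ c‖ ^ 2 * ‖bondDiff c w k‖ ^ 2 := mul_pow _ _ _
  unfold longForm plainForm
  rw [← tsum_mul_left]
  exact Summable.tsum_le_tsum hle (Summable.of_nonneg_of_le (fun k => sq_nonneg _) hle hs) hs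

/-- **Far-bond bound:** on the window, a class outside `classesR R` (`R ≥ 2`) has
`classTerm_c ≥ −farCoeff c · plainForm c w` (`ρ = ‖ζ⁰_c‖ > R`, `‖ζ‖ ≥ ρ − 5/189`,
`r = ‖Aζ‖ ≥ (189/200)‖ζ‖ > 1`, `ψ(r) ≥ 0`, `ω(r) ≥ −8r⁻¹⁰`, `8r⁻¹⁰‖ζ‖² ≤ 18ρ⁻⁸`). [folklore] -/
theorem neg_farCoeff_mul_le {R : ℝ} (hR : 2 ≤ R)
    {A B : EuclideanSpace ℝ (Fin 3) →L[ℝ] EuclideanSpace ℝ (Fin 3)} {δ : EuclideanSpace ℝ (Fin 3)}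
    {w : Label → EuclideanSpace ℝ (Fin 3)} (hW : CellWindow A) (hδ : ShiftWindow A δ)
    (hw : (support w).Finite) {c : BondClass} (hc : c ∉ classesR R) :
    -(farCoeff c * plainForm c w) ≤ classTerm A B δ w c := by
  have hρ : R < ‖bondVec 0 c‖ := lt_norm_of_notMem hc
  have hε : ‖δ‖ ≤ 5 / 189 := norm_shift_le hW hδ
  have h1 : ‖bondVec 0 c‖ - 5 / 189 ≤ ‖bondVec δ c‖ := by
    have ha := norm_sub_norm_le (bondVec 0 c) (bondVec δ c)
    have hb := norm_bondVec_sub_le δ c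
    rw [norm_sub_rev] at hb
    linarith
  have h2 : 189 / 200 * ‖bondVec δ c‖ ≤ ‖A (bondVec δ c)‖ := (hW (bondVec δ c)).1
  have hρ2 : 2 ≤ ‖bondVec 0 c‖ := by linarith
  have hsc : 8 * ‖A (bondVec δ c)‖⁻¹ ^ 10 * ‖bondVec δ c‖ ^ 2 ≤ farCoeff c := far_scalar hρ2 h1 h2
  have hr1 : 1 ≤ ‖A (bondVec δ c)‖ := by linarith
  have hi0 : 0 ≤ ‖A (bondVec δ c)‖⁻¹ := inv_nonneg.mpr (norm_nonneg _)
  have hi1 : ‖A (bondVec δ c)‖⁻¹ ≤ 1 := inv_le_one_of_one_le₀ hr1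
  have hψ : 0 ≤ psiLJ ‖A (bondVec δ c)‖ := by
    unfold psiLJ
    have : ‖A (bondVec δ c)‖⁻¹ ^ 14 ≤ ‖A (bondVec δ c)‖⁻¹ ^ 8 :=
      pow_le_pow_of_le_one hi0 hi1 (by norm_num)
    linarith
  have hω : -(8 * ‖A (bondVec δ c)‖⁻¹ ^ 10) ≤ omegaLJ ‖A (bondVec δ c)‖ := by
    unfold omegaLJ
    have : 0 ≤ ‖A (bondVec δ c)‖⁻¹ ^ 16 := pow_nonneg hi0 16
    linarith
  unfold classTerm
  exact far_combine (metricForm_nonneg B c w) (longForm_nonneg δ c w) (plainForm_nonneg c w) hψ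
    (pow_nonneg hi0 10) hω (longForm_le δ c hw) hsc

/-! ## The stub -/

/-- **S3 — TAIL CONTROL** (`stub_tail`): for `R ≥ 2` on the window, the far part of the class family is
bounded below by minus the explicit tail functional,
`−tailForm R w ≤ ∑' c, (if c ∈ classesR R then 0 else classTerm A B δ w c)`, both families being summable
by the two summability hypotheses. [folklore] -/
theorem stub_tail : TailControl := by
  intro R hR A B δ w hW hδ hw hls hsum
  have hfin : Summable fun c => if c ∈ classesR R then classTerm A B δ w c else 0 :=
    summable_of_hasFiniteSupport ((classesR R).finite_toSet.subset (by
      intro c hc; by_contra h; exact hc (if_neg h)))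
  have hfar : Summable fun c => if c ∈ classesR R then 0 else classTerm A B δ w c := by
    have : (fun c => if c ∈ classesR R then 0 else classTerm A B δ w c) =
        fun c => classTerm A B δ w c - if c ∈ classesR R then classTerm A B δ w c else 0 := by
      funext c; split_ifs <;> simp
    rw [this]; exact hsum.sub hfin
  have htail : Summable fun c => if c ∈ classesR R then 0 else farCoeff c * plainForm c w := by
    refine Summable.of_nonneg_of_le (fun c => ?_) (fun c => ?_) (hls.mul_left 18)
    · split_ifs
      · exact le_rfl
      · exact mul_nonneg (farCoeff_nonneg c) (plainForm_nonneg c w)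
    · split_ifs
      · exact mul_nonneg (by norm_num) (mul_nonneg (by positivity) (plainForm_nonneg c w))
      · show 18 * ‖bondVec 0 c‖⁻¹ ^ 8 * plainForm c w ≤ 18 * (‖bondVec 0 c‖⁻¹ ^ 8 * plainForm c w)
        rw [mul_assoc]
  rw [tailForm, ← tsum_neg]
  refine Summable.tsum_le_tsum (fun c => ?_) htail.neg hfar
  by_cases hc : c ∈ classesR R
  · simp [hc]
  · simp only [hc, if_false]
    exact neg_farCoeff_mul_le hR hW hδ hw hc

end Summit.AtomisticToContinuum.Crystallization.Theorems.PhononStabilityCWC.TailStub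

end
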